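import Literature.NumberTheory.EllipticCurves.TwoDescentLocalI0
import Literature.NumberTheory.EllipticCurves.TwoDescentRankBounds
import Literature.NumberTheory.EllipticCurves.BSDAnalyticRank
import HarnessLib

/-!
# Rank bounds from the complete `2`-descent over `ℚ` with linear local conditions

The complete `2`-descent `δ : E(ℚ) → ℚ^×/ℚ^{×2} × ℚ^×/ℚ^{×2}` of an elliptic curve
`E : y² = (x - e₁)(x - e₂)(x - e₃)` with rational `2`-torsion (Silverman, *The Arithmetic of
Elliptic Curves*, 2nd ed., Prop. X.1.4; tree `twoDescentMap`, kernel `2E(ℚ)`) bounds the rank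
through `#E(ℚ)/2E(ℚ) = 2^{r+2}`. This file packages the two directions in the form used by the
rank computations for the congruent number curves `E_n : y² = x³ - n²x` of
`Literature/Barriers/BirchSwinnertonDyer/RankNotSumOfLocalInvariantsCN*.lean`:

* `mordellWeilRank_le_of_linear_conditions` — **upper bound**: if an additive
  `ψ : E(ℚ) → (ℤ/2)^N` detects the descent class (`ψ P = 0 ⟹ δ P = 0`), separates the
  `2`-torsion, and its values satisfy `k` independent linear conditions (`κ ∘ ψ = 0` with
  `κ : (ℤ/2)^N ↠ (ℤ/2)^k`) then `rk E(ℚ) ≤ N - k - 2` (tree `pow_finrank_add_two_le_natCard_range`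
  and the Mordell–Weil theorem `WeierstrassCurve.module_finite_point_holds`); in practice `ψ` is
  the vector of sign and valuation-parity characters of `δ₁, δ₂` (tree `signHom`, `parityHom`)
  and the conditions are the local conditions of `TwoDescentLocalOdd/I0.lean`;
* `le_mordellWeilRank_of_twoTorsion'` — **lower bound** from independent values of `ψ`
  (tree `linearIndependent_of_twoTorsion`);
  both stated for an ARBITRARY `DecidableEq` instance on the base field (the group law behind
  `WeierstrassCurve.mordellWeilRank` is the classical one; `Subsingleton (DecidableEq K)`);
* the bookkeeping that makes "ψ detects the class" checkable: a rational representative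
  `descentRep` of `δ₁(P)` (`twoDescentComponent_eq_sqClass`), its positivity when `e₁` is the
  smallest root (`descentRep_pos`), even valuation off the primes dividing `(e₁-e₂)(e₁-e₃)`
  (`even_padicValRat_descentRep`, tree `Curve24A1.even_padicValRat_sub`), hence
  `twoDescentComponent_eq_one`; the case distinction `point_cases` (`O`, `T₁, T₂, T₃`, or `y' ≠ 0`
  with `y'² = (x - e₁)(x - e₂)(x - e₃)`); `natCard_ker_of_surjective`;
* for `E_n`: `splitTwoTorsion_cn` (roots `-n, 0, n`), `cn_nonsingular_iff`, `point_cases_cn`.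

Everything is proved; no named facts.

## References

* J. H. Silverman, *The Arithmetic of Elliptic Curves*, 2nd ed., GTM 106 (2009), Prop. X.1.4
  (Complete 2-Descent), Example X.1.5, pp. 270–271 of the held copy; Thm. VIII.6.7
  (Mordell–Weil). [SilvermanAEC2009]
-/

noncomputable section

/-! ## Frame: from local conditions to rank bounds -/

namespace Literature.NumberTheory.EllipticCurves.TwoDescentLocal

open WeierstrassCurve WeierstrassCurve.Affine WeierstrassCurve.Affine.Point
open Literature.NumberTheory.EllipticCurves.KramerTwoDescent

section Frame

variable {W : Affine ℚ} {e₁ e₂ e₃ : ℚ}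

/-- A rational representative of the first `2`-descent component `δ₁(P) ∈ ℚ^×/ℚ^{×2}`:
`1` at `O`, `(e₁ - e₂)(e₁ - e₃)` at `T₁`, `x - e₁` otherwise (Silverman AEC Prop. X.1.4).
[cite: SilvermanAEC2009, Prop. X.1.4] -/
def descentRep (e₁ e₂ e₃ : ℚ) : W.Point → ℚ
  | 0 => 1
  | .some x _ _ => if x = e₁ then (e₁ - e₂) * (e₁ - e₃) else x - e₁

/-- The representative at `O` is `1`. [folklore] -/
theorem descentRep_zero : descentRep (W := W) e₁ e₂ e₃ 0 = 1 := rfl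

/-- The representative at `T₁` is `(e₁ - e₂)(e₁ - e₃)`. [folklore] -/
theorem descentRep_some_of_eq {x y : ℚ} (hP : W.Nonsingular x y) (hx : x = e₁) :
    descentRep e₁ e₂ e₃ (.some x y hP) = (e₁ - e₂) * (e₁ - e₃) := by
  rw [descentRep, if_pos hx]

/-- The representative at `(x, y)`, `x ≠ e₁`, is `x - e₁`. [folklore] -/
theorem descentRep_some_of_ne {x y : ℚ} (hP : W.Nonsingular x y) (hx : x ≠ e₁) :
    descentRep e₁ e₂ e₃ (.some x y hP) = x - e₁ := by
  rw [descentRep, if_neg hx]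

/-- `δ₁(P)` is the class of its representative. [cite: SilvermanAEC2009, Prop. X.1.4] -/
theorem twoDescentComponent_eq_sqClass (P : W.Point) :
    twoDescentComponent W e₁ e₂ e₃ P = sqClass (descentRep e₁ e₂ e₃ P) := by
  rcases P with _ | ⟨x, y, hP⟩
  · show (1 : SqUnits ℚ) = sqClass 1
    rw [← mul_one (1 : ℚ), sqClass_mul_self]
  · by_cases hx : x = e₁
    · rw [twoDescentComponent_some_of_eq hP hx, descentRep_some_of_eq hP hx]
    · rw [twoDescentComponent_some_of_ne hP hx, descentRep_some_of_ne hP hx]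

variable [W.IsElliptic]

/-- The representative is non-zero. [folklore] -/
theorem descentRep_ne_zero (h : W.SplitTwoTorsion e₁ e₂ e₃) (P : W.Point) :
    descentRep e₁ e₂ e₃ P ≠ 0 := by
  rcases P with _ | ⟨x, y, hP⟩
  · exact one_ne_zero
  · by_cases hx : x = e₁
    · rw [descentRep_some_of_eq hP hx]; exact h.c_ne_zero
    · rw [descentRep_some_of_ne hP hx]; exact sub_ne_zero.mpr hx

/-- **Case distinction for rational points**: `P` is `O`, one of the `2`-torsion points
`T₁, T₂, T₃`, or an affine point `(x, y)` off the `2`-torsion, for which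
`y' = y + (a₁x + a₃)/2 ≠ 0` and `y'² = (x - e₁)(x - e₂)(x - e₃)`. [folklore] -/
theorem point_cases (h : W.SplitTwoTorsion e₁ e₂ e₃) (P : W.Point) :
    P = 0 ∨ P = .some e₁ _ (nonsingular_twoTorsion h) ∨
      P = .some e₂ _ (nonsingular_twoTorsion h.swap₁₂) ∨
      P = .some e₃ _ (nonsingular_twoTorsion h.swap₂₃.swap₁₂) ∨
      ∃ (x y : ℚ) (hP : W.Nonsingular x y), P = .some x y hP ∧ x ≠ e₁ ∧ x ≠ e₂ ∧ x ≠ e₃ ∧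
        y + (W.a₁ * x + W.a₃) / 2 ≠ 0 ∧
        (y + (W.a₁ * x + W.a₃) / 2) ^ 2 = (x - e₁) * (x - e₂) * (x - e₃) := by
  rcases P with _ | ⟨x, y, hP⟩
  · exact Or.inl rfl
  right
  have hsq := sq_eq_mul_mul_of_equation h hP.left
  by_cases hy : y + (W.a₁ * x + W.a₃) / 2 = 0
  · have hyT : y = W.twoTorsionY x := by rw [twoTorsionY]; linear_combination hy
    rw [hy, zero_pow two_ne_zero, zero_eq_mul, mul_eq_zero] at hsq
    rcases hsq with (h1 | h2) | h3
    · left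
      have hx : x = e₁ := by linear_combination h1
      subst hx hyT; rfl
    · right; left
      have hx : x = e₂ := by linear_combination h2
      subst hx hyT; rfl
    · right; right; left
      have hx : x = e₃ := by linear_combination h3
      subst hx hyT; rfl
  · right; right; right
    refine ⟨x, y, hP, rfl, ?_, ?_, ?_, hy, hsq⟩
    · rintro rfl; exact hy (pow_eq_zero_iff two_ne_zero |>.mp (by rw [hsq]; ring))
    · rintro rfl; exact hy (pow_eq_zero_iff two_ne_zero |>.mp (by rw [hsq]; ring))
    · rintro rfl; exact hy (pow_eq_zero_iff two_ne_zero |>.mp (by rw [hsq]; ring))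

/-- **Off the bad primes the representative has even valuation** (all points, including the
`2`-torsion): the content of `δ(E(ℚ)) ⊆ ℚ(S,2)²`. [cite: SilvermanAEC2009, Prop. X.1.4] -/
theorem even_padicValRat_descentRep (h : W.SplitTwoTorsion e₁ e₂ e₃) (P : W.Point) {q : ℕ}
    [Fact q.Prime] (h12 : padicValRat q (e₁ - e₂) = 0) (h13 : padicValRat q (e₁ - e₃) = 0) :
    Even (padicValRat q (descentRep e₁ e₂ e₃ P)) := by
  rcases point_cases h P with rfl | rfl | rfl | rfl | ⟨x, y, hP, rfl, hx₁, hx₂, hx₃, hy, hsq⟩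
  · rw [descentRep_zero, padicValRat.one]; exact ⟨0, rfl⟩
  · rw [descentRep_some_of_eq _ rfl, padicValRat.mul (sub_ne_zero.mpr h.ne₁₂)
      (sub_ne_zero.mpr h.ne₁₃), h12, h13]; exact ⟨0, rfl⟩
  · rw [descentRep_some_of_ne _ (Ne.symm h.ne₁₂), show e₂ - e₁ = -(e₁ - e₂) by ring,
      padicValRat.neg, h12]; exact ⟨0, rfl⟩
  · rw [descentRep_some_of_ne _ (Ne.symm h.ne₁₃), show e₃ - e₁ = -(e₁ - e₃) by ring,
      padicValRat.neg, h13]; exact ⟨0, rfl⟩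
  · rw [descentRep_some_of_ne _ hx₁]
    exact Curve24A1.even_padicValRat_sub q h.ne₁₂ h.ne₁₃ h12 h13 hy hsq

/-- With `e₁` the smallest root the representative of `δ₁(P)` is positive, for every `P`.
[cite: SilvermanAEC2009, Prop. X.1.4] -/
theorem descentRep_pos (h : W.SplitTwoTorsion e₁ e₂ e₃) (h12 : e₁ < e₂) (h13 : e₁ < e₃)
    (P : W.Point) : 0 < descentRep e₁ e₂ e₃ P := by
  rcases point_cases h P with rfl | rfl | rfl | rfl | ⟨x, y, hP, rfl, hx₁, hx₂, hx₃, hy, hsq⟩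
  · rw [descentRep_zero]; exact one_pos
  · rw [descentRep_some_of_eq _ rfl]; nlinarith
  · rw [descentRep_some_of_ne _ (Ne.symm h.ne₁₂)]; linarith
  · rw [descentRep_some_of_ne _ (Ne.symm h.ne₁₃)]; linarith
  · rw [descentRep_some_of_ne _ hx₁]; exact (sub_pos_of_lt_of_lt hsq hy h12 h13).1

/-- The sign of the representative, read off from `signBit`. [folklore] -/
theorem descentRep_pos_of_signBit (h : W.SplitTwoTorsion e₁ e₂ e₃) (P : W.Point)
    (hs : signBit (descentRep e₁ e₂ e₃ P) = 0) : 0 < descentRep e₁ e₂ e₃ P :=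
  lt_of_le_of_ne ((signBit_eq_zero_iff (descentRep_ne_zero h P)).mp hs).le
    (descentRep_ne_zero h P).symm

/-- **Square classes are detected by sign and parities**: if the representative of `δ₁(P)` is
positive and has even valuation at the finitely many primes `T` containing all primes dividing
`(e₁ - e₂)(e₁ - e₃)`, then `δ₁(P) = 1`. [cite: SilvermanAEC2009, Prop. X.1.4] -/
theorem twoDescentComponent_eq_one (h : W.SplitTwoTorsion e₁ e₂ e₃) (P : W.Point) (T : Finset ℕ)
    (hT : ∀ q : ℕ, q.Prime → q ∉ T → padicValRat q (e₁ - e₂) = 0 ∧ padicValRat q (e₁ - e₃) = 0)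
    (hpos : 0 < descentRep e₁ e₂ e₃ P)
    (heven : ∀ q ∈ T, Even (padicValRat q (descentRep e₁ e₂ e₃ P))) :
    twoDescentComponent W e₁ e₂ e₃ P = 1 := by
  rw [twoDescentComponent_eq_sqClass]
  refine sqClass_eq_one_of_forall (descentRep_ne_zero h P) hpos fun q hq => ?_
  by_cases hqT : q ∈ T
  · exact heven q hqT
  · haveI : Fact q.Prime := ⟨hq⟩
    exact even_padicValRat_descentRep h P (hT q hq hqT).1 (hT q hq hqT).2

end Frame

section Torsion

variable {F : Type*} [Field F] [DecidableEq F] [CharZero F] {W : Affine F} [W.IsElliptic]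
  {e₁ e₂ e₃ : F}

/-- `2 T₁ = O`. [folklore] -/
theorem two_nsmul_twoTorsion (h : W.SplitTwoTorsion e₁ e₂ e₃) :
    (2 : ℕ) • (Point.some e₁ _ (nonsingular_twoTorsion h) : W.Point) = 0 := by
  rw [two_nsmul]
  exact add_self_of_Y_eq (negY_twoTorsionY e₁).symm

/-- `T₁` has finite order. [folklore] -/
theorem isOfFinAddOrder_twoTorsion (h : W.SplitTwoTorsion e₁ e₂ e₃) :
    IsOfFinAddOrder (Point.some e₁ _ (nonsingular_twoTorsion h) : W.Point) :=
  isOfFinAddOrder_iff_nsmul_eq_zero.mpr ⟨2, two_pos, two_nsmul_twoTorsion h⟩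

end Torsion

section Helpers

/-- A prime outside an explicit list of primes does not divide their product. [folklore] -/
theorem not_dvd_of_eq_prod {q : ℕ} (hq : q.Prime) (l : List ℕ) (hl : ∀ a ∈ l, a.Prime)
    (hql : q ∉ l) {m : ℤ} (hm : m.natAbs = l.prod) : ¬ (q : ℤ) ∣ m := by
  intro hd
  have hd' : q ∣ l.prod := hm ▸ Int.natCast_dvd.mp hd
  obtain ⟨a, ha, hqa⟩ := (Prime.dvd_prod_iff (Nat.prime_iff.mp hq)).mp hd'
  exact hql ((Nat.prime_dvd_prime_iff_eq hq (hl a ha)).mp hqa ▸ ha)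

/-- Hence such a prime is a unit for that integer. [folklore] -/
theorem padicValRat_eq_zero_of_eq_prod {q : ℕ} (hq : q.Prime) (l : List ℕ) (hl : ∀ a ∈ l, a.Prime)
    (hql : q ∉ l) {m : ℤ} (hm : m.natAbs = l.prod) : padicValRat q (m : ℚ) = 0 :=
  padicValRat_intCast_eq_zero (not_dvd_of_eq_prod hq l hl hql hm)

end Helpers

section Count

/-- Cardinality of the kernel of a surjection `(ℤ/2)^N → (ℤ/2)^k`. [folklore] -/
theorem natCard_ker_of_surjective {N k : ℕ} (κ : (Fin N → ZMod 2) →+ (Fin k → ZMod 2))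
    (hκ : Function.Surjective κ) : Nat.card κ.ker * 2 ^ k = 2 ^ N := by
  have h1 := κ.ker.card_mul_index
  rw [AddSubgroup.index_ker, AddMonoidHom.range_eq_top.mpr hκ] at h1
  simp only [Nat.card_eq_fintype_card, Fintype.card_pi, ZMod.card,
    Finset.prod_const, Finset.card_univ, Fintype.card_fin] at h1
  simpa [Nat.card_eq_fintype_card, Fintype.card_pi, ZMod.card] using h1

/-- **Rank bound from a complete `2`-descent with linear local conditions** (Silverman AEC
Prop. X.1.4 with the Mordell–Weil theorem): let `ψ : E(ℚ) → (ℤ/2)^N` be an additive map that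
DETECTS the `2`-descent class (`ψ P = 0 ⟹ δ(P) = 0`, so `ker ψ ⊆ 2E(ℚ)`), separates the
`2`-torsion, and whose values satisfy `k` independent linear conditions
(`κ ∘ ψ = 0`, `κ : (ℤ/2)^N ↠ (ℤ/2)^k`). Then `2^{r+2} ≤ #ψ(E(ℚ)) ≤ #ker κ = 2^{N-k}`, so
`r ≤ N - k - 2`. [cite: SilvermanAEC2009, Prop. X.1.4] -/
theorem mordellWeilRank_le_of_linear_conditions {K : Type*} [Field K] [NumberField K]
    [inst : DecidableEq K] {W : WeierstrassCurve K} [W.IsElliptic]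
    {e₁ e₂ e₃ : K} (h : W.toAffine.SplitTwoTorsion e₁ e₂ e₃) {N k s : ℕ} (hN : N = k + (s + 2))
    (ψ : W.toAffine.Point →+ (Fin N → ZMod 2)) (κ : (Fin N → ZMod 2) →+ (Fin k → ZMod 2))
    (hker : ∀ P, ψ P = 0 → twoDescentMap h P = 0) (hkill : ∀ P, κ (ψ P) = 0)
    (hκ : Function.Surjective κ)
    (h₁ : ψ (.some e₁ _ (nonsingular_twoTorsion h)) ≠ 0)
    (h₂ : ψ (.some e₂ _ (nonsingular_twoTorsion h.swap₁₂)) ≠ 0)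
    (h₃ : ψ (.some e₁ _ (nonsingular_twoTorsion h) + .some e₂ _ (nonsingular_twoTorsion h.swap₁₂)) ≠ 0)
    (h₁₂ : ψ (.some e₁ _ (nonsingular_twoTorsion h)) ≠ ψ (.some e₂ _ (nonsingular_twoTorsion h.swap₁₂))) :
    W.mordellWeilRank ≤ s := by
  -- the group law behind `mordellWeilRank` is elaborated against the classical instance
  have e : inst = fun a b => Classical.propDecidable (a = b) := Subsingleton.elim _ _
  subst e
  letI : DecidableEq K := fun a b => Classical.propDecidable (a = b)
  haveI : Module.Finite ℤ W.toAffine.Point := W.module_finite_point_holds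
  have hker' : ∀ a, ψ a = 0 → ∃ b, a = 2 • b := fun a ha => by
    have ha' : a ∈ (twoDescentMap h).ker := hker a ha
    rw [ker_twoDescentMap h] at ha'
    obtain ⟨b, hb⟩ := ha'
    exact ⟨b, hb.symm⟩
  have hbound := pow_finrank_add_two_le_natCard_range ψ hker' (isOfFinAddOrder_twoTorsion h)
    (isOfFinAddOrder_twoTorsion h.swap₁₂) h₁ h₂ h₃ h₁₂
  have hle : ψ.range ≤ κ.ker := by
    rintro _ ⟨P, rfl⟩
    exact hkill P
  have hcard : Nat.card ψ.range ≤ Nat.card κ.ker := AddSubgroup.card_le_of_le hle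
  have hkerc := natCard_ker_of_surjective κ hκ
  have key : 2 ^ (Module.finrank ℤ W.toAffine.Point + 2) * 2 ^ k ≤ 2 ^ N := by
    rw [← hkerc]; exact Nat.mul_le_mul_right _ (hbound.trans hcard)
  rw [← pow_add, hN] at key
  have := (Nat.pow_le_pow_iff_right (by norm_num)).mp key
  unfold WeierstrassCurve.mordellWeilRank
  omega

/-- **Lower bounds** (tree `linearIndependent_of_twoTorsion`, Silverman AEC Prop. X.1.4, made
honest by the Mordell–Weil theorem), stated for an arbitrary `DecidableEq` instance on the base
field: if `ψ T₃ = ψ T₁ + ψ T₂` and the values `ψ P₁, …, ψ P_r, ψ T₁, ψ T₂` are `ℤ/2`-linearly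
independent then `r ≤ rk E(K)`. [cite: SilvermanAEC2009, Prop. X.1.4] -/
theorem le_mordellWeilRank_of_twoTorsion' {K : Type*} [Field K] [NumberField K]
    [inst : DecidableEq K] {W : WeierstrassCurve K} [W.IsElliptic] {e₁ e₂ e₃ : K}
    (h : W.toAffine.SplitTwoTorsion e₁ e₂ e₃) {V : Type*} [AddCommGroup V] [Module (ZMod 2) V]
    (ψ : W.toAffine.Point →+ V) {r : ℕ} (P : Fin r → W.toAffine.Point)
    (h₃ : ψ (.some _ _ (nonsingular_twoTorsion h.swap₂₃.swap₁₂)) =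
      ψ (.some _ _ (nonsingular_twoTorsion h)) + ψ (.some _ _ (nonsingular_twoTorsion h.swap₁₂)))
    (hind : ∀ (c : Fin r → ZMod 2) (ε₁ ε₂ : ZMod 2),
      ∑ i, c i • ψ (P i) + ε₁ • ψ (.some _ _ (nonsingular_twoTorsion h)) +
        ε₂ • ψ (.some _ _ (nonsingular_twoTorsion h.swap₁₂)) = 0 → c = 0 ∧ ε₁ = 0 ∧ ε₂ = 0) :
    r ≤ W.mordellWeilRank := by
  have e : inst = fun a b => Classical.propDecidable (a = b) := Subsingleton.elim _ _
  subst e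
  letI : DecidableEq K := fun a b => Classical.propDecidable (a = b)
  haveI : Module.Finite ℤ W.toAffine.Point := W.module_finite_point_holds
  have hli := (linearIndependent_of_twoTorsion h ψ P h₃ hind).fintype_card_le_finrank
  rw [Fintype.card_fin] at hli
  unfold WeierstrassCurve.mordellWeilRank
  exact hli

end Count

section CongruentNumber

open Literature.NumberTheory.EllipticCurves

/-- `E_n : y² = x³ - n²x = (x + n) x (x - n)` has rational `2`-torsion `-n, 0, n`. [folklore] -/
theorem splitTwoTorsion_cn (n : ℕ) :
    (congruentNumberCurve n).toAffine.SplitTwoTorsion (-(n : ℚ)) 0 n where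
  b₂_eq := by
    rw [show (congruentNumberCurve n).toAffine.b₂ = (congruentNumberCurve n).b₂ from rfl, b₂,
      congruentNumberCurve_a₁, congruentNumberCurve_a₂]; ring
  b₄_eq := by
    rw [show (congruentNumberCurve n).toAffine.b₄ = (congruentNumberCurve n).b₄ from rfl, b₄,
      congruentNumberCurve_a₁, congruentNumberCurve_a₃, congruentNumberCurve_a₄]; ring
  b₆_eq := by
    rw [show (congruentNumberCurve n).toAffine.b₆ = (congruentNumberCurve n).b₆ from rfl, b₆,
      congruentNumberCurve_a₃, congruentNumberCurve_a₆]; ring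

/-- `a₁(E_n) = 0` on the affine curve. [folklore] -/
theorem cn_affine_a₁ (n : ℕ) : (congruentNumberCurve n).toAffine.a₁ = 0 := rfl

/-- `a₃(E_n) = 0` on the affine curve. [folklore] -/
theorem cn_affine_a₃ (n : ℕ) : (congruentNumberCurve n).toAffine.a₃ = 0 := rfl

/-- The equation of `E_n` in product form. [folklore] -/
theorem cn_equation_iff (n : ℕ) (x y : ℚ) :
    (congruentNumberCurve n).toAffine.Equation x y ↔ y ^ 2 = (x - -(n : ℚ)) * (x - 0) * (x - n) := by
  rw [WeierstrassCurve.Affine.equation_iff]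
  simp only [cn_affine_a₁, cn_affine_a₃,
    show (congruentNumberCurve n).toAffine.a₂ = 0 from rfl,
    show (congruentNumberCurve n).toAffine.a₄ = -((n : ℚ) ^ 2) from rfl,
    show (congruentNumberCurve n).toAffine.a₆ = 0 from rfl]
  constructor <;> intro h <;> linear_combination h

/-- Nonsingularity on `E_n` (`n ≠ 0`) is just the equation. [folklore] -/
theorem cn_nonsingular_iff {n : ℕ} (hn : n ≠ 0) (x y : ℚ) :
    (congruentNumberCurve n).toAffine.Nonsingular x y ↔
      y ^ 2 = (x - -(n : ℚ)) * (x - 0) * (x - n) := by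
  haveI := isElliptic_congruentNumberCurve hn
  rw [← WeierstrassCurve.Affine.equation_iff_nonsingular, cn_equation_iff]

/-- **Case distinction for the rational points of `E_n`** (`n ≠ 0`): `O`, the `2`-torsion
`(-n, 0), (0, 0), (n, 0)`, or `(x, y)` with `y ≠ 0`, `y² = (x + n) x (x - n)`. [folklore] -/
theorem point_cases_cn {n : ℕ} (hn : n ≠ 0) (P : (congruentNumberCurve n).toAffine.Point) :
    haveI := isElliptic_congruentNumberCurve hn
    P = 0 ∨ P = .some _ _ (nonsingular_twoTorsion (splitTwoTorsion_cn n)) ∨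
      P = .some _ _ (nonsingular_twoTorsion (splitTwoTorsion_cn n).swap₁₂) ∨
      P = .some _ _ (nonsingular_twoTorsion (splitTwoTorsion_cn n).swap₂₃.swap₁₂) ∨
      ∃ (x y : ℚ) (hP : (congruentNumberCurve n).toAffine.Nonsingular x y), P = .some x y hP ∧
        x ≠ -(n : ℚ) ∧ x ≠ 0 ∧ x ≠ n ∧ y ≠ 0 ∧ y ^ 2 = (x - -(n : ℚ)) * (x - 0) * (x - n) := by
  haveI := isElliptic_congruentNumberCurve hn
  have key := point_cases (splitTwoTorsion_cn n) P
  simp only [cn_affine_a₁, cn_affine_a₃, zero_mul, add_zero, zero_div] at key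
  exact key

end CongruentNumber

end Literature.NumberTheory.EllipticCurves.TwoDescentLocal

end
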